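import Summits.HodgeConjecture.HodgeConjecture.Theorems.Ring2WeilCoverageCMFieldOddDegreeRationalRows
import Summits.HodgeConjecture.HodgeConjecture.Theorems.Ring2WeilCoverageCMFieldCarrierIrreducible
import Summits.HodgeConjecture.HodgeConjecture.Theorems.Ring2WeilCoverageCMFieldSexticCarriers
import Literature.NumberTheory.QuadraticFields.BinaryQuadraticFormsPrimeRepresentation
import HarnessLib

/-!
# Ring 2 — Weil-type family-coverage census, CM-field rows (X-AE): the COMPOSITE sextic carriers `ℚ(ζ₇)⁺(i)` and
# `ℚ(ζ₉)⁺(i)` in the kernel, and their rational rows `[q] = [1] ⟺ q = x² + y²` — open cell (xviii′)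

HONEST FRAMING: research route conditional on HC_CM; not a corollary; Q11.4-sentence-2 already refuted in dim ≥ 3.

Cell `pub-hodge-ring2`, seat `ring2-b03` (gen 59), census `WEIL-FAMILY-COVERAGE.md` «## b03» b03.24 P.S. Two of the four
composite sextic CM fields of the b03.23 tables (kit j209882), in Deligne's presentation `E = ℚ(η)`, `η = iθ`,
`θ = ζ + ζ⁻¹`, `σ = η² = −θ²`:

* `ℚ(ζ₇)⁺(i) ⊂ ℚ(ζ₂₈)`: `R₂₈ = S³ + 5S² + 6S + 1` (the minimal polynomial of `−θ₇²`; `R₂₈(S) = −R₇(−S − 4)` since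
  `θ² = (ζ − ζ⁻¹)² + 4`);
* `ℚ(ζ₉)⁺(i) ⊂ ℚ(ζ₃₆)`: `R₃₆ = S³ + 6S² + 9S + 1` (`R₃₆(S) = −R₉(−S − 4)`).

For each: `R` irreducible over `ℤ` (no root mod `2`) hence over `ℚ` (Gauss) — the `Fact` for `F`; the roots of `R` are
REAL (they are `−4 −` a root of `R₇`, resp. `R₉`, real by part X-V) and NEGATIVE (all coefficients positive); hence
the `Fact` for `E` by part X-AD (`fact_irreducible_cmPolyQ_of_roots_real_neg`, no Eisenstein prime); `t = −(σ+2)/(σ+1)`,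
resp. `t = σ + 3`, has `σt² = −1` (`s = tη = ±i`): `E ⊇ ℚ(i)`. Then part X-AC gives the rational rows in closed form
and §1 the class of every prime, uniformly for `K = ℚ(i)`:

* `mk_prime_eq_split_iff_of_neg_one`: on ANY odd-degree carrier with `σt² = −1`, for a prime `ℓ`:
  `[ℓ] = [1] ⟺ ℓ = 2 ∨ ℓ ≡ 1 (mod 4)` (Fermat's two squares from the tree's Cox file; `x² + y²` anisotropic mod
  `ℓ ≡ 3 (mod 4)`, part X-Z descent);
* `R28_…`, `R36_…`: `irreducible_int`, `fact_realPolyQ`, `roots_real_neg`, `fact_cmPolyQ`, `root_mul_sq_eq_neg_one`,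
  **`…_mk_eq_split_iff`** (`[q] = [1] ⟺ ∃ x y : ℚ, q = x² + y²`) and **`…_mk_prime_eq_split_iff`**.

READING against the tables of b03.23 (3): `ℚ(ζ₇)⁺(i)`: rational classes `[7], [3], [21]` (`7, 3 ≡ 3 (mod 4)`), 7 of the
32 `S6`-classes rational ✓; `ℚ(ζ₉)⁺(i)`: `[3], [19], [57]` ✓. THEOREMS ONLY: no `def`, no named fact, no `sorry`; `HC_CM`
does not occur; nothing about the Hodge conjecture is asserted.

## References
* [Deligne1982HodgeCycles] P. Deligne (notes by J. S. Milne), LNM 900 (1982), §4 p. 30 (1), Cor. 4.2.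
* [Cox2013] D. A. Cox, *Primes of the form x² + ny²*, 2nd ed., §1 (1.1) (Fermat, two squares).
* [Washington1997] L. C. Washington, *Introduction to Cyclotomic Fields*, GTM 83, Ch. 2.
-/

noncomputable section

set_option linter.dupNamespace false

open Polynomial

namespace Summit.HodgeConjecture.HodgeConjecture.Ring2.WeilCoverageCM

open Literature.AlgebraicGeometry.Deligne1982
open Literature.AlgebraicGeometry.HodgeTheory (splitDiscriminantClassCM)
open Literature.NumberTheory.QuadraticFields.Quadratic (exists_eq_sq_add_sq_iff)

/-! ### §1 `K = ℚ(i)`: the class of every prime, on any odd-degree carrier with `σt² = −1` -/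

section GaussianPrimes

variable {R : Polynomial ℤ} [Fact (Irreducible (realPolyQ R))] [Fact (Irreducible (cmPolyQ R))]

/-- **`[ℓ] = [1] ⟺ ℓ = 2 ∨ ℓ ≡ 1 (mod 4)`** for a prime `ℓ`, on any carrier with `[F:ℚ]` odd and `t ∈ F`, `σt² = −1`
(`E ⊇ ℚ(i)`): by part X-AC `[ℓ] = [1] ⟺ ℓ = x² + y²` over `ℚ`; `2 = 1 + 1`, an odd prime `ℓ ≡ 1 (4)` is a sum of two
integer squares (Fermat), and for `ℓ ≡ 3 (4)` the form `x² + y²` is anisotropic mod `ℓ` (`−1` a non-square), so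
`ℓ ≠ x² + y²` over `ℚ` (part X-Z descent). [cite: Cox2013, §1 (1.1)] [cite: Deligne1982HodgeCycles, §4 Cor. 4.2] -/
theorem mk_prime_eq_split_iff_of_neg_one (hodd : Odd R.natDegree) (t : realField R)
    (ht : AdjoinRoot.root (realPolyQ R) * t ^ 2 = AdjoinRoot.of (realPolyQ R) (-1)) {ℓ : ℕ} (hℓ : ℓ.Prime)
    (q : (realField R)ˣ) (hq : (q : realField R) = AdjoinRoot.of (realPolyQ R) (ℓ : ℚ)) :
    (QuotientGroup.mk q : cmNormResidueGroup R) = splitDiscriminantClassCM R 2 ↔ (ℓ = 2 ∨ ℓ % 4 = 1) := by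
  rw [mk_eq_splitDiscriminantClassCM_two_iff_of_odd hodd one_pos t ht q hq]
  constructor
  · rintro ⟨x, y, hxy⟩
    by_contra hne
    rw [not_or] at hne
    have hℓ4 : ℓ % 4 = 3 := by
      have hodd' : ℓ % 2 = 1 := Nat.odd_iff.mp (hℓ.odd_of_ne_two hne.1)
      omega
    haveI := Fact.mk hℓ
    have hns : ¬ IsSquare ((-1 : ℤ) : ZMod ℓ) := by
      rw [Int.cast_neg, Int.cast_one, ZMod.exists_sq_eq_neg_one_iff]
      exact fun h => h hℓ4
    exact prime_mul_ne_binaryForm hℓ 0 1 (aniso_sq_add_mul_sq_of_not_isSquare 1 hns) 1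
      (fun hd => hℓ.one_lt.ne' (by exact_mod_cast Int.eq_one_of_dvd_one (by positivity) hd)) x y
      (by push_cast; linear_combination hxy)
  · rintro (rfl | h4)
    · exact ⟨1, 1, by norm_num⟩
    · have hℓ2 : ℓ ≠ 2 := by omega
      obtain ⟨x, y, hxy⟩ := (exists_eq_sq_add_sq_iff hℓ hℓ2).2 h4
      exact ⟨x, y, by rw [one_mul]; exact_mod_cast hxy⟩

end GaussianPrimes

/-! ### §2 The carrier `R₂₈ = S³ + 5S² + 6S + 1` of `ℚ(ζ₇)⁺(i)` -/

/-- `S³ + 5S² + 6S + 1` is irreducible over `ℤ`: it is monic and has no root mod `2` (`S³ + S² + 1`). [folklore] -/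
theorem R28_irreducible_int : Irreducible (X ^ 3 + C (5 : ℤ) * X ^ 2 + C 6 * X + C 1 : Polynomial ℤ) := by
  have hmonic : (X ^ 3 + C (5 : ℤ) * X ^ 2 + C 6 * X + C 1 : Polynomial ℤ).Monic := by monicity!
  refine hmonic.irreducible_of_irreducible_map (Int.castRingHom (ZMod 2)) _ ?_
  have hmap : Polynomial.map (Int.castRingHom (ZMod 2)) (X ^ 3 + C (5 : ℤ) * X ^ 2 + C 6 * X + C 1) =
      X ^ 3 + X ^ 2 + 1 := by
    simp only [Polynomial.map_add, Polynomial.map_mul, Polynomial.map_pow, map_X, map_C]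
    have h5 : (Int.castRingHom (ZMod 2)) 5 = 1 := by decide
    have h6 : (Int.castRingHom (ZMod 2)) 6 = 0 := by decide
    have h1 : (Int.castRingHom (ZMod 2)) 1 = 1 := by decide
    rw [h5, h6, h1, C_1, C_0, one_mul, zero_mul, add_zero]
  rw [hmap]
  have hm2 : (X ^ 3 + X ^ 2 + 1 : Polynomial (ZMod 2)).Monic := by monicity!
  have hd2 : (X ^ 3 + X ^ 2 + 1 : Polynomial (ZMod 2)).natDegree = 3 := by compute_degree!
  rw [hm2.irreducible_iff_roots_eq_zero_of_degree_le_three (by rw [hd2]; norm_num) (by rw [hd2])]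
  refine Multiset.eq_zero_of_forall_notMem fun a ha => ?_
  rw [mem_roots hm2.ne_zero, IsRoot.def, eval_add, eval_add, eval_pow, eval_pow, eval_X, eval_one] at ha
  fin_cases a <;> revert ha <;> decide

/-- The `Fact` for `F = ℚ[S]/(S³ + 5S² + 6S + 1) = ℚ(ζ₇)⁺` (Gauss). [folklore] -/
theorem R28_fact_realPolyQ : Fact (Irreducible (realPolyQ (X ^ 3 + C 5 * X ^ 2 + C 6 * X + C 1 : Polynomial ℤ))) := by
  refine ⟨?_⟩
  have hmonic : (X ^ 3 + C (5 : ℤ) * X ^ 2 + C 6 * X + C 1 : Polynomial ℤ).Monic := by monicity!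
  have h := (hmonic.irreducible_iff_irreducible_map_fraction_map (K := ℚ)).1 R28_irreducible_int
  rwa [algebraMap_int_eq] at h

/-- **The roots of `S³ + 5S² + 6S + 1` are real and negative**: a root `s` gives the root `−s − 4` of
`S³ + 7S² + 14S + 7` (`R₂₈(S) = −R₇(−S−4)`), which is real (part X-V `zeta7_roots_real_neg`); and a real root of a
polynomial with positive coefficients is negative. [cite: Washington1997, Ch. 2] -/
theorem R28_roots_real_neg :
    ∀ s : ℂ, Polynomial.eval₂ (Int.castRingHom ℂ) s (X ^ 3 + C 5 * X ^ 2 + C 6 * X + C 1 : Polynomial ℤ) = 0 →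
      s.im = 0 ∧ s.re < 0 := by
  haveI := zeta7_fact_cmPolyQ
  intro s hs
  simp only [eval₂_add, eval₂_mul, eval₂_pow, eval₂_X, eval₂_ofNat, eval₂_one, eq_intCast, Int.cast_ofNat,
    Int.cast_one] at hs
  have h7 : Polynomial.eval₂ (Int.castRingHom ℂ) (-s - 4) (X ^ 3 + C 7 * X ^ 2 + C 14 * X + C 7 : Polynomial ℤ) = 0 := by
    simp only [eval₂_add, eval₂_mul, eval₂_pow, eval₂_X, eval₂_ofNat, eq_intCast, Int.cast_ofNat]
    linear_combination (-1 : ℂ) * hs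
  obtain ⟨him, -⟩ := zeta7_roots_real_neg (R := X ^ 3 + C 7 * X ^ 2 + C 14 * X + C 7) rfl (-s - 4) h7
  have hsim : s.im = 0 := by
    have : (-s - 4 : ℂ).im = -s.im := by simp
    rw [this] at him
    linarith
  refine ⟨hsim, ?_⟩
  have hsr : s = (s.re : ℂ) := Complex.ext (by simp) (by simp [hsim])
  rw [hsr] at hs
  have hC : ((s.re ^ 3 + 5 * s.re ^ 2 + 6 * s.re + 1 : ℝ) : ℂ) = 0 := by
    push_cast
    exact hs
  have hr : s.re ^ 3 + 5 * s.re ^ 2 + 6 * s.re + 1 = 0 := Complex.ofReal_eq_zero.mp hC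
  by_contra hge
  have h0 : 0 ≤ s.re := not_lt.mp hge
  nlinarith [mul_nonneg (mul_nonneg h0 h0) h0, mul_nonneg h0 h0]

/-- The `Fact` for `E = ℚ[T]/(T⁶ + 5T⁴ + 6T² + 1) = ℚ(ζ₇)⁺(i)` — by part X-AD, no Eisenstein prime. [folklore] -/
theorem R28_fact_cmPolyQ : Fact (Irreducible (cmPolyQ (X ^ 3 + C 5 * X ^ 2 + C 6 * X + C 1 : Polynomial ℤ))) :=
  haveI := R28_fact_realPolyQ
  fact_irreducible_cmPolyQ_of_roots_real_neg (by monicity!) R28_roots_real_neg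

section R28

variable {R : Polynomial ℤ} [Fact (Irreducible (realPolyQ R))]

/-- **`i ∈ ℚ(ζ₇)⁺(i)` on the carrier: `t = −(σ+2)/(σ+1)` has `σt² = −1`** (`σ(σ+2)² + (σ+1)² = R₂₈(σ) = 0`; `t = 1/θ`).
[cite: Deligne1982HodgeCycles, §4 p. 30] -/
theorem R28_root_mul_sq_eq_neg_one (hR : R = X ^ 3 + C 5 * X ^ 2 + C 6 * X + C 1) :
    AdjoinRoot.root (realPolyQ R) *
        (-(AdjoinRoot.root (realPolyQ R) + 2) / (AdjoinRoot.root (realPolyQ R) + 1)) ^ 2 =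
      AdjoinRoot.of (realPolyQ R) (-1) := by
  have hRQ : realPolyQ R = X ^ 3 + C (5 : ℚ) * X ^ 2 + C (6 : ℚ) * X + C (1 : ℚ) := by
    have h := realPolyQ_eq_of_cubic R hR
    push_cast at h
    exact h
  have hσ := root_rel_of_realPolyQ_eq hRQ
  simp only [map_ofNat, map_one] at hσ
  have hne : AdjoinRoot.root (realPolyQ R) + 1 ≠ 0 := by
    intro h0
    have hm1 : AdjoinRoot.root (realPolyQ R) = -1 := by linear_combination h0
    rw [hm1] at hσ
    norm_num at hσ
  rw [map_neg, map_one, div_pow, ← mul_div_assoc, div_eq_iff (pow_ne_zero 2 hne)]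
  linear_combination hσ

variable [Fact (Irreducible (cmPolyQ R))]

/-- **The rational rows of `W12.ℚ(ζ₇)⁺(i)`: `[q] = [(−1)²] = [1] ⟺ q = x² + y²` for some `x, y ∈ ℚ`** (part X-AC with
`K = ℚ(i)`). Table of b03.23: `[7], [3], [21]` non-split (`7, 3 ≡ 3 mod 4`). [cite: Deligne1982HodgeCycles, §4 p. 30 (1) and Cor. 4.2] -/
theorem R28_mk_eq_split_iff (hR : R = X ^ 3 + C 5 * X ^ 2 + C 6 * X + C 1) {c : ℚ} (q : (realField R)ˣ)
    (hq : (q : realField R) = AdjoinRoot.of (realPolyQ R) c) :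
    (QuotientGroup.mk q : cmNormResidueGroup R) = splitDiscriminantClassCM R 2 ↔ ∃ x y : ℚ, c = x ^ 2 + y ^ 2 := by
  have hodd : Odd R.natDegree := by rw [(monic_and_natDegree_of_cubic R hR).2]; exact ⟨1, rfl⟩
  rw [mk_eq_splitDiscriminantClassCM_two_iff_of_odd hodd one_pos _ (R28_root_mul_sq_eq_neg_one hR) q hq]
  simp only [one_mul]

/-- **The class of every prime in the `ℚ(ζ₇)⁺(i)` table: `[ℓ] = [1] ⟺ ℓ = 2 ∨ ℓ ≡ 1 (mod 4)`.**
[cite: Cox2013, §1 (1.1)] [cite: Deligne1982HodgeCycles, §4 Cor. 4.2] -/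
theorem R28_mk_prime_eq_split_iff (hR : R = X ^ 3 + C 5 * X ^ 2 + C 6 * X + C 1) {ℓ : ℕ} (hℓ : ℓ.Prime)
    (q : (realField R)ˣ) (hq : (q : realField R) = AdjoinRoot.of (realPolyQ R) (ℓ : ℚ)) :
    (QuotientGroup.mk q : cmNormResidueGroup R) = splitDiscriminantClassCM R 2 ↔ (ℓ = 2 ∨ ℓ % 4 = 1) := by
  have hodd : Odd R.natDegree := by rw [(monic_and_natDegree_of_cubic R hR).2]; exact ⟨1, rfl⟩
  exact mk_prime_eq_split_iff_of_neg_one hodd _ (R28_root_mul_sq_eq_neg_one hR) hℓ q hq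

end R28

/-! ### §3 The carrier `R₃₆ = S³ + 6S² + 9S + 1` of `ℚ(ζ₉)⁺(i)` -/

/-- `S³ + 6S² + 9S + 1` is irreducible over `ℤ`: monic with no root mod `2` (`S³ + S + 1`). [folklore] -/
theorem R36_irreducible_int : Irreducible (X ^ 3 + C (6 : ℤ) * X ^ 2 + C 9 * X + C 1 : Polynomial ℤ) := by
  have hmonic : (X ^ 3 + C (6 : ℤ) * X ^ 2 + C 9 * X + C 1 : Polynomial ℤ).Monic := by monicity!
  refine hmonic.irreducible_of_irreducible_map (Int.castRingHom (ZMod 2)) _ ?_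
  have hmap : Polynomial.map (Int.castRingHom (ZMod 2)) (X ^ 3 + C (6 : ℤ) * X ^ 2 + C 9 * X + C 1) =
      X ^ 3 + X + 1 := by
    simp only [Polynomial.map_add, Polynomial.map_mul, Polynomial.map_pow, map_X, map_C]
    have h6 : (Int.castRingHom (ZMod 2)) 6 = 0 := by decide
    have h9 : (Int.castRingHom (ZMod 2)) 9 = 1 := by decide
    have h1 : (Int.castRingHom (ZMod 2)) 1 = 1 := by decide
    rw [h6, h9, h1, C_1, C_0, one_mul, zero_mul, add_zero]
  rw [hmap]
  have hm2 : (X ^ 3 + X + 1 : Polynomial (ZMod 2)).Monic := by monicity!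
  have hd2 : (X ^ 3 + X + 1 : Polynomial (ZMod 2)).natDegree = 3 := by compute_degree!
  rw [hm2.irreducible_iff_roots_eq_zero_of_degree_le_three (by rw [hd2]; norm_num) (by rw [hd2])]
  refine Multiset.eq_zero_of_forall_notMem fun a ha => ?_
  rw [mem_roots hm2.ne_zero, IsRoot.def, eval_add, eval_add, eval_pow, eval_X, eval_one] at ha
  fin_cases a <;> revert ha <;> decide

/-- The `Fact` for `F = ℚ[S]/(S³ + 6S² + 9S + 1) = ℚ(ζ₉)⁺` (Gauss). [folklore] -/
theorem R36_fact_realPolyQ : Fact (Irreducible (realPolyQ (X ^ 3 + C 6 * X ^ 2 + C 9 * X + C 1 : Polynomial ℤ))) := by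
  refine ⟨?_⟩
  have hmonic : (X ^ 3 + C (6 : ℤ) * X ^ 2 + C 9 * X + C 1 : Polynomial ℤ).Monic := by monicity!
  have h := (hmonic.irreducible_iff_irreducible_map_fraction_map (K := ℚ)).1 R36_irreducible_int
  rwa [algebraMap_int_eq] at h

/-- **The roots of `S³ + 6S² + 9S + 1` are real and negative** (`R₃₆(S) = −R₉(−S−4)` and part X-V
`zeta9_roots_real_neg`; positive coefficients). [cite: Washington1997, Ch. 2] -/
theorem R36_roots_real_neg :
    ∀ s : ℂ, Polynomial.eval₂ (Int.castRingHom ℂ) s (X ^ 3 + C 6 * X ^ 2 + C 9 * X + C 1 : Polynomial ℤ) = 0 →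
      s.im = 0 ∧ s.re < 0 := by
  haveI := zeta9_fact_cmPolyQ
  intro s hs
  simp only [eval₂_add, eval₂_mul, eval₂_pow, eval₂_X, eval₂_ofNat, eval₂_one, eq_intCast, Int.cast_ofNat,
    Int.cast_one] at hs
  have h9 : Polynomial.eval₂ (Int.castRingHom ℂ) (-s - 4) (X ^ 3 + C 6 * X ^ 2 + C 9 * X + C 3 : Polynomial ℤ) = 0 := by
    simp only [eval₂_add, eval₂_mul, eval₂_pow, eval₂_X, eval₂_ofNat, eq_intCast, Int.cast_ofNat]
    linear_combination (-1 : ℂ) * hs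
  obtain ⟨him, -⟩ := zeta9_roots_real_neg (R := X ^ 3 + C 6 * X ^ 2 + C 9 * X + C 3) rfl (-s - 4) h9
  have hsim : s.im = 0 := by
    have : (-s - 4 : ℂ).im = -s.im := by simp
    rw [this] at him
    linarith
  refine ⟨hsim, ?_⟩
  have hsr : s = (s.re : ℂ) := Complex.ext (by simp) (by simp [hsim])
  rw [hsr] at hs
  have hC : ((s.re ^ 3 + 6 * s.re ^ 2 + 9 * s.re + 1 : ℝ) : ℂ) = 0 := by
    push_cast
    exact hs
  have hr : s.re ^ 3 + 6 * s.re ^ 2 + 9 * s.re + 1 = 0 := Complex.ofReal_eq_zero.mp hC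
  by_contra hge
  have h0 : 0 ≤ s.re := not_lt.mp hge
  nlinarith [mul_nonneg (mul_nonneg h0 h0) h0, mul_nonneg h0 h0]

/-- The `Fact` for `E = ℚ[T]/(T⁶ + 6T⁴ + 9T² + 1) = ℚ(ζ₉)⁺(i)` — by part X-AD. [folklore] -/
theorem R36_fact_cmPolyQ : Fact (Irreducible (cmPolyQ (X ^ 3 + C 6 * X ^ 2 + C 9 * X + C 1 : Polynomial ℤ))) :=
  haveI := R36_fact_realPolyQ
  fact_irreducible_cmPolyQ_of_roots_real_neg (by monicity!) R36_roots_real_neg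

section R36

variable {R : Polynomial ℤ} [Fact (Irreducible (realPolyQ R))]

/-- **`i ∈ ℚ(ζ₉)⁺(i)` on the carrier: `t = σ + 3` has `σt² = −1`** (`σ(σ+3)² + 1 = R₃₆(σ) = 0`; `t = 1/θ`).
[cite: Deligne1982HodgeCycles, §4 p. 30] -/
theorem R36_root_mul_sq_eq_neg_one (hR : R = X ^ 3 + C 6 * X ^ 2 + C 9 * X + C 1) :
    AdjoinRoot.root (realPolyQ R) * (AdjoinRoot.root (realPolyQ R) + 3) ^ 2 = AdjoinRoot.of (realPolyQ R) (-1) := by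
  have hRQ : realPolyQ R = X ^ 3 + C (6 : ℚ) * X ^ 2 + C (9 : ℚ) * X + C (1 : ℚ) := by
    have h := realPolyQ_eq_of_cubic R hR
    push_cast at h
    exact h
  have hσ := root_rel_of_realPolyQ_eq hRQ
  simp only [map_ofNat, map_one] at hσ
  rw [map_neg, map_one]
  linear_combination hσ

variable [Fact (Irreducible (cmPolyQ R))]

/-- **The rational rows of `W12.ℚ(ζ₉)⁺(i)`: `[q] = [(−1)²] = [1] ⟺ q = x² + y²` for some `x, y ∈ ℚ`** (part X-AC with
`K = ℚ(i)`). Table of b03.23: `[3], [19], [57]` non-split. [cite: Deligne1982HodgeCycles, §4 p. 30 (1) and Cor. 4.2] -/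
theorem R36_mk_eq_split_iff (hR : R = X ^ 3 + C 6 * X ^ 2 + C 9 * X + C 1) {c : ℚ} (q : (realField R)ˣ)
    (hq : (q : realField R) = AdjoinRoot.of (realPolyQ R) c) :
    (QuotientGroup.mk q : cmNormResidueGroup R) = splitDiscriminantClassCM R 2 ↔ ∃ x y : ℚ, c = x ^ 2 + y ^ 2 := by
  have hodd : Odd R.natDegree := by rw [(monic_and_natDegree_of_cubic R hR).2]; exact ⟨1, rfl⟩
  rw [mk_eq_splitDiscriminantClassCM_two_iff_of_odd hodd one_pos _ (R36_root_mul_sq_eq_neg_one hR) q hq]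
  simp only [one_mul]

/-- **The class of every prime in the `ℚ(ζ₉)⁺(i)` table: `[ℓ] = [1] ⟺ ℓ = 2 ∨ ℓ ≡ 1 (mod 4)`.**
[cite: Cox2013, §1 (1.1)] [cite: Deligne1982HodgeCycles, §4 Cor. 4.2] -/
theorem R36_mk_prime_eq_split_iff (hR : R = X ^ 3 + C 6 * X ^ 2 + C 9 * X + C 1) {ℓ : ℕ} (hℓ : ℓ.Prime)
    (q : (realField R)ˣ) (hq : (q : realField R) = AdjoinRoot.of (realPolyQ R) (ℓ : ℚ)) :
    (QuotientGroup.mk q : cmNormResidueGroup R) = splitDiscriminantClassCM R 2 ↔ (ℓ = 2 ∨ ℓ % 4 = 1) := by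
  have hodd : Odd R.natDegree := by rw [(monic_and_natDegree_of_cubic R hR).2]; exact ⟨1, rfl⟩
  exact mk_prime_eq_split_iff_of_neg_one hodd _ (R36_root_mul_sq_eq_neg_one hR) hℓ q hq

end R36

end Summit.HodgeConjecture.HodgeConjecture.Ring2.WeilCoverageCM

end
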